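import Summits.ResolutionOfSingularities.ResolutionOfSingularities.Theorems.HilbertSamuelEliminationCampaignW42ToricMarkedDefs

/-!
# [OURS · L1 W4.2 · tri-2 R13-KM] Board persistence of legal faces (kernel form of TRIAGE-r13 §R13-KM (KM-1)(d))

On the dimension-3 toric marked board (`TState`), a LEGAL face `P` (= an in-stratum, boundary-permissible member-face
centre through the corner) survives, legal, under every legal blow-up whose centre `R` is not contained in `P`; and every
cone containing a legal face is unresolved.  Consequently every e-resolving legal play from a state holding a legal face `P`
contains a blow-up of a sub-face of `P` (the face itself, or a ray of it = a surface containing the curve): an exact corner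
lying on an in-stratum member-face curve is never resolved by centres avoiding that curve, and procedure Q (or any
terminating legal policy) plays a sub-face of it after finitely many moves on its lineage.  Board face of the geometric
permanence lemma of TRIAGE-r13 §R13-MM (MM-c).  AI-written; weaker than expert review; nothing of [Hironaka2017].
-/

set_option linter.dupNamespace false

namespace Summit.ResolutionOfSingularities.ResolutionOfSingularities.Theorems.CampaignW42.Toric.TState

variable {ι : Type}

/-- **[OURS · L1 W4.2]** Persistence: a legal face `P` stays a legal face after any legal blow-up `R` with `¬ R ⊆ P`
(well-formed state: the new ray is fresh). -/
theorem legal_persists_of_not_subset {m : ℕ} {s : TState ι} (hW : s.WF) {P R : Finset ℕ}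
    (hP : s.Legal m P) (hRP : ¬ R ⊆ P) : (s.move m R).Legal m P := by
  obtain ⟨⟨hPne, C, hC, hPC⟩, hsum⟩ := hP
  have hnC : s.next ∉ C := hW.next_notMem hC
  have hnP : s.next ∉ P := fun h => hnC (hPC h)
  refine ⟨⟨hPne, ?_⟩, fun v => by rw [faceSum_move_of_not_mem hnP]; exact hsum v⟩
  by_cases hRC : R ⊆ C
  · -- some `x ∈ R ∖ P`; the child `(C ∖ {x}) ∪ {ρ}` still contains `P`
    obtain ⟨x, hxR, hxP⟩ := Finset.not_subset.mp hRP
    refine ⟨insert s.next (C.erase x), ?_, ?_⟩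
    · rw [mem_move_cones]
      exact ⟨C, hC, by rw [children_of_subset hRC, Finset.mem_image]; exact ⟨x, hxR, rfl⟩⟩
    · intro r hr
      exact Finset.mem_insert_of_mem (Finset.mem_erase.mpr ⟨fun h => hxP (h ▸ hr), hPC hr⟩)
  · refine ⟨C, ?_, hPC⟩
    rw [mem_move_cones]
    exact ⟨C, hC, by rw [children_of_not_subset hRC, Finset.mem_singleton]⟩

/-- **[OURS · L1 W4.2]** A state holding a legal face is not e-resolved (orders only add up). -/
theorem not_eResolved_of_legal {m : ℕ} {s : TState ι} (hs : s.Nonneg) {P : Finset ℕ} (hP : s.Legal m P) :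
    ¬ s.EResolved m := by
  obtain ⟨C, hC, hPC⟩ := hP.1.2
  exact fun h => not_resolved_of_legal_subset hs hP hPC (h C hC)

/-- **[OURS · L1 W4.2]** Every e-resolving legal play from a (well-formed, non-negative) state holding a legal face `P`
passes through a state — reached by a legal play, still holding `P` as a legal face — at which a sub-face `R ⊆ P` is
legally blown up.  (For any terminating legal policy, e.g. procedure Q: the lineage of `P` ends only with a centre
containing the stratum of `P`.) -/
theorem Play.exists_subface_step_of_legal {m : ℕ} {s t : TState ι} (h : s.Play m t) :
    s.WF → s.Nonneg → t.EResolved m → ∀ {P : Finset ℕ}, s.Legal m P →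
      ∃ u : TState ι, ∃ R : Finset ℕ, s.Play m u ∧ u.Legal m P ∧ u.Legal m R ∧ R ⊆ P := by
  induction h with
  | refl s =>
      intro _ hs ht P hP
      exact absurd ht (not_eResolved_of_legal hs hP)
  | @step s t R hR _ ih =>
      intro hW hs ht P hP
      by_cases hRP : R ⊆ P
      · exact ⟨s, R, Play.refl s, hP, hR, hRP⟩
      · obtain ⟨u, R', hplay, hP', hR', hsub⟩ :=
          ih (hW.move R) (hs.move hR) ht (legal_persists_of_not_subset hW hP hRP)
        exact ⟨u, R', Play.step R hR hplay, hP', hR', hsub⟩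

/-- **[OURS · L1 W4.2]** Pointwise corollary: if a state holding a legal face `P` is e-resolvable at all, some legal
play reaches a state where a sub-face of `P` is a legal centre while `P` is still legal. -/
theorem exists_subface_step_of_eResolvable {m : ℕ} {s : TState ι} (hW : s.WF) (hs : s.Nonneg)
    (h : s.EResolvable m) {P : Finset ℕ} (hP : s.Legal m P) :
    ∃ u : TState ι, ∃ R : Finset ℕ, s.Play m u ∧ u.Legal m P ∧ u.Legal m R ∧ R ⊆ P := by
  obtain ⟨t, hplay, ht⟩ := h
  exact hplay.exists_subface_step_of_legal hW hs ht hP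

end Summit.ResolutionOfSingularities.ResolutionOfSingularities.Theorems.CampaignW42.Toric.TState
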